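import Literature.AlgebraicGeometry.Resolution.Henselization
import Literature.AlgebraicGeometry.Resolution.ValuationConjugation
import Mathlib.FieldTheory.PurelyInseparable.Basic
import Mathlib.FieldTheory.IsAlgClosed.Basic
import HarnessLib

/-!
# The henselization is henselian (Kuhlmann 2010, §1.1) — discharge of `Kuhlmann2010HenselizationIsHenselian`

Topic: `Literature/AlgebraicGeometry/Resolution` (valued function fields). D-0014 keeps
`Literature/` sorry-free by stating cited results as named facts `def X : Prop`; this sibling
of `Henselization.lean` PROVES its named fact `Kuhlmann2010HenselizationIsHenselian`:

* `Kuhlmann2010HenselizationIsHenselian_holds` — for `Ω` algebraically closed, `V` a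
  valuation ring of `Ω` and `E ≤ Ω`, the henselization `E^h = henselization V E` (the
  decomposition field of `V ∩ E^sep` in `E^sep|E`) valued by `V ∩ E^h` is a henselian field
  (`IsHenselianField`: the valuation ring extends uniquely to every algebraic extension),

following F.-V. Kuhlmann, *Elimination of ramification I*, Trans. AMS 362 (2010), §1.1:

> Take a valued field `(K,v)` and fix an extension of the valuation `v` to the
> separable-algebraic closure `K^sep` of `K`. Then … the henselization `K^h` of `(K,v)` (with
> respect to the chosen extension of `v`) [is] the decomposition field … of the extension
> `(K^sep|K,v)`. Since all extensions of the valuation `v` from `K` to `K^sep` are conjugate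
> (i.e., are obtained from each other by composing with an automorphism of `K^sep|K`), these
> fields are unique up to valuation preserving isomorphism. … If `K^h = K`, then `(K,v)` is
> called henselian. This holds if and only if the extension of `v` from `K` to every algebraic
> extension field is unique.

For the proofs Kuhlmann refers to "[En], [R], [W], [Z–S]" (§2.1); we follow N. Bourbaki,
*Algèbre commutative*, Ch. VI §8 no. 6 — Cor. 1 of Prop. 7, the conjugation theorem, PROVED in
`ValuationConjugation.lean` (`exists_smul_eq_of_isGalois`), and Cor. 2 (purely inseparable
extensions) — and infinite Galois theory (Mathlib, `InfiniteGalois.fixingSubgroup_fixedField`).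

## Proof architecture (`Kuhlmann2010HenselizationIsHenselian_holds`)

Write `E^sep = separableClosure E Ω`, `Γ = Gal(E^sep|E)`, `D ≤ Γ` the decomposition group of
`V ∩ E^sep`, `E^h = Fix(D)`.

1. `isClosed_decompositionGroup`: `D` is closed for the Krull topology (`D = ⋂ₓ {σ | x ∈ V ↔
   σ x ∈ V}`, each set clopen — a union of cosets of the open stabiliser of `x`,
   `stabilizer_isOpen_of_isIntegral`; the argument of Neukirch, ANT II §9, as run for ideals in
   `Literature.NumberTheory.GaloisRepresentations.isClosed_setOf_smul_mem_of_isOpen_stabilizer`),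
   hence `Gal(E^sep|E^h) = D` by the Galois correspondence for closed subgroups
   (`InfiniteGalois.fixingSubgroup_fixedField`): `mem_decompositionGroup_of_forall_apply_eq`.
2. `mem_iff_mem_of_mem_separableClosure` — **uniqueness on `E^sep`**: if a valuation ring `W`
   of `Ω` agrees with `V` on `E^h`, it agrees with `V` on `E^sep`. Indeed `W ∩ E^sep` and
   `V ∩ E^sep` lie over the same valuation ring of `E^h`, so by the conjugation theorem
   (`exists_smul_eq_of_isGalois` of `ValuationConjugation.lean`, Bourbaki VI §8 no. 6 Cor. 1,
   applied to the Galois extension `E^sep|E^h`) `V ∩ E^sep = τ • (W ∩ E^sep)` for some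
   `τ ∈ Gal(E^sep|E^h) = D`; as `τ` stabilises `V ∩ E^sep`, `W ∩ E^sep = V ∩ E^sep`.
3. `mem_iff_mem_of_isIntegral` — **purely inseparable lift** (Bourbaki VI §8 no. 6, Cor. 2):
   every `x` algebraic over `E` has a power `x^m`, `m = p^n ≥ 1`, in `E^sep`
   (`exists_pow_mem_separableClosure`, separable contraction of the minimal polynomial), and
   `x ∈ W ↔ x^m ∈ W` for a valuation ring; so `W` agrees with `V` on all of `E`'s algebraic
   closure in `Ω`.
4. Assembly: an algebraic extension `L` of `E^h` embeds into `Ω` over `E^h`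
   (`IsAlgClosed.lift`); a valuation ring `O` of `L` over `V ∩ E^h` extends along the embedding
   to a valuation ring `W` of `Ω` (Chevalley, Mathlib `IsLocalRing.exists_factor_valuationRing`)
   with `O = W ∩ L` because valuation rings are maximal for domination
   (`eq_of_le_of_inv_mem`); by 3, `x ∈ O ↔ φ(x) ∈ V`, independently of `O`. Hence any two such
   `O₁`, `O₂` coincide.

## References

* F.-V. Kuhlmann, *Elimination of ramification I: The generalized stability theorem*, Trans.
  Amer. Math. Soc. 362 (2010) 5697–5727 = arXiv:1003.5678, §1.1 and Lemma 2.3. [Kuhlmann2010]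
* N. Bourbaki, *Algèbre commutative, Chapitres 5 à 7* (Hermann 1975; Springer 2006), Ch. VI
  §8 no. 6, Prop. 7, Cor. 1 and Cor. 2 (p. 139 of the Springer reprint). [BourbakiAC5to7]

## Rendering notes

* Everything is stated in the ambient rendering of `Henselization.lean` (`Ω : Type u`, one
  universe, as the named fact quantifies over `Ω L : Type u`).
* What is NOT here: the other named facts of `Henselization.lean`
  (`Kuhlmann2010ExtensionsConjugate` — immediate from `exists_smul_eq_of_isGalois` —,
  `Kuhlmann2010HenselizationImmediate`, `Kuhlmann2010HenselizationUniversal`,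
  `Kuhlmann2010DefectlessIffHenselization`).
-/

noncomputable section

open scoped Pointwise

open IsLocalRing Polynomial

namespace Literature.AlgebraicGeometry.Resolution

universe u

/-! ### General lemmas -/

/-- **Valuation rings are maximal for domination**: if `O ≤ O'` are valuation rings of a field
and every element of `O` invertible in `O'` is invertible in `O`, then `O = O'` (Bourbaki,
AC VI §1 no. 2, Thm. 1; cf. Mathlib `ValuationSubring.isMax_toLocalSubring`). [folklore] -/
theorem eq_of_le_of_inv_mem {L : Type*} [Field L] {O O' : ValuationSubring L} (hle : O ≤ O')
    (hdom : ∀ x ∈ O, x⁻¹ ∈ O' → x⁻¹ ∈ O) : O = O' := by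
  refine le_antisymm hle fun y hy => ?_
  rcases O.mem_or_inv_mem y with h | h
  · exact h
  · have := hdom y⁻¹ h (by rwa [inv_inv])
    rwa [inv_inv] at this

/-- `x^m ∈ O ↔ x ∈ O` for a valuation ring `O` and `m ≠ 0` (`v(x^m) = v(x)^m ≤ 1 ↔ v(x) ≤ 1`).
[folklore] -/
theorem pow_mem_iff_mem {L : Type*} [Field L] (O : ValuationSubring L) {m : ℕ} (hm : m ≠ 0)
    (x : L) : x ^ m ∈ O ↔ x ∈ O := by
  rw [← O.valuation_le_one_iff, ← O.valuation_le_one_iff, map_pow]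
  exact pow_le_one_iff hm

/-- **Separable contraction**: an element `x` integral over a field `E` has a power `x^m`,
`m = p^n ≠ 0` (`p` the exponential characteristic), which is separable over `E`, i.e. lies in
the relative separable closure (Mathlib `Irreducible.hasSeparableContraction` for the minimal
polynomial; Bourbaki, *Algèbre* V §7). [folklore] -/
theorem exists_pow_mem_separableClosure {Ω : Type*} [Field Ω] (E : Subfield Ω) {x : Ω}
    (hx : IsIntegral E x) : ∃ m : ℕ, m ≠ 0 ∧ x ^ m ∈ separableClosure E Ω := by
  obtain ⟨q, hq⟩ := ExpChar.exists E
  obtain ⟨g, hg, n, hn⟩ := (minpoly.irreducible hx).hasSeparableContraction q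
  refine ⟨q ^ n, pow_ne_zero n (expChar_pos E q).ne', mem_separableClosure_iff.mpr ?_⟩
  exact hg.of_dvd (minpoly.dvd E _ (by rw [← expand_aeval, hn, minpoly.aeval]))

/-! ### The decomposition group is closed; `Gal(E^sep|E^h) = D` -/

section Ambient

variable {Ω : Type u} [Field Ω] (V : ValuationSubring Ω) (E : Subfield Ω)

/-- The decomposition group as an intersection: `σ ∈ D ↔ ∀ x ∈ E^sep, (x ∈ V ↔ σ x ∈ V)`.
[folklore] -/
theorem coe_decompositionGroup_eq_iInter :
    (decompositionGroup V E : Set ((separableClosure E Ω) ≃ₐ[E] (separableClosure E Ω))) =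
      ⋂ x : separableClosure E Ω,
        {σ | σ • x ∈ {y : separableClosure E Ω | ((x : Ω) ∈ V ↔ (y : Ω) ∈ V)}} := by
  ext σ
  simp only [SetLike.mem_coe, mem_decompositionGroup_iff, Set.mem_iInter, Set.mem_setOf_eq]
  constructor
  · intro h x
    have hx := ValuationSubring.smul_mem_pointwise_smul_iff (g := σ)
      (S := sepClosureValuationSubring V E) (x := x)
    rw [h, mem_sepClosureValuationSubring_iff, mem_sepClosureValuationSubring_iff] at hx
    exact hx.symm
  · intro h
    ext y
    rw [ValuationSubring.mem_pointwise_smul_iff_inv_smul_mem, mem_sepClosureValuationSubring_iff,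
      mem_sepClosureValuationSubring_iff]
    have hy := h (σ⁻¹ • y)
    rw [smul_inv_smul] at hy
    exact hy

/-- **The decomposition group is closed** in `Gal(E^sep|E)` for the Krull topology: it is the
intersection over `x ∈ E^sep` of the clopen sets `{σ | x ∈ V ↔ σ x ∈ V}` (stabilisers of
elements are open, Mathlib `stabilizer_isOpen_of_isIntegral`). (Neukirch, *Algebraic Number
Theory*, Ch. II §9, remark after (9.3): decomposition groups are closed.) [folklore] -/
theorem isClosed_decompositionGroup :
    IsClosed (decompositionGroup V E :
      Set ((separableClosure E Ω) ≃ₐ[E] (separableClosure E Ω))) := by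
  rw [coe_decompositionGroup_eq_iInter]
  refine isClosed_iInter fun x => ?_
  -- the sets `{σ | σ • x ∈ S}` are open: unions of left cosets of the open stabiliser of `x`
  have key : ∀ S : Set (separableClosure E Ω),
      IsOpen {σ : (separableClosure E Ω) ≃ₐ[E] (separableClosure E Ω) | σ • x ∈ S} := fun S => by
    have h : {σ : (separableClosure E Ω) ≃ₐ[E] (separableClosure E Ω) | σ • x ∈ S} =
        {σ : (separableClosure E Ω) ≃ₐ[E] (separableClosure E Ω) | σ • x ∈ S} *
          (MulAction.stabilizer ((separableClosure E Ω) ≃ₐ[E] (separableClosure E Ω)) x :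
            Set ((separableClosure E Ω) ≃ₐ[E] (separableClosure E Ω))) := by
      ext σ
      constructor
      · intro hσ
        exact ⟨σ, hσ, 1, one_mem _, mul_one σ⟩
      · rintro ⟨τ, hτ, η, hη, rfl⟩
        show (τ * η) • x ∈ S
        rwa [mul_smul, MulAction.mem_stabilizer_iff.mp hη]
    rw [h]
    exact (stabilizer_isOpen_of_isIntegral (K := E) x).mul_left
  rw [← isOpen_compl_iff, Set.compl_setOf]
  exact key {y : separableClosure E Ω | ((x : Ω) ∈ V ↔ (y : Ω) ∈ V)}ᶜ

/-- **`Gal(E^sep|E^h) = D`** (the decomposition field is the fixed field of the CLOSED subgroup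
`D`, so its fixing group is `D` itself — infinite Galois correspondence,
`InfiniteGalois.fixingSubgroup_fixedField`): an automorphism of `E^sep|E` fixing `E^h`
pointwise lies in the decomposition group. For `Ω` algebraically closed (`E^sep|E` Galois).
[cite: Kuhlmann2010, Section 1.1] -/
theorem mem_decompositionGroup_of_forall_apply_eq [IsAlgClosed Ω]
    (τ : (separableClosure E Ω) ≃ₐ[E] (separableClosure E Ω))
    (hτ : ∀ x : separableClosure E Ω, (x : Ω) ∈ henselization V E → τ x = x) :
    τ ∈ decompositionGroup V E := by
  let D : ClosedSubgroup ((separableClosure E Ω) ≃ₐ[E] (separableClosure E Ω)) :=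
    ⟨decompositionGroup V E, isClosed_decompositionGroup V E⟩
  have hD : (IntermediateField.fixedField (decompositionGroup V E)).fixingSubgroup =
      decompositionGroup V E :=
    InfiniteGalois.fixingSubgroup_fixedField D
  rw [← hD]
  refine (mem_fixingSubgroup_iff _).mpr fun x hx => ?_
  rw [AlgEquiv.smul_def]
  apply hτ
  rw [mem_henselization_iff]
  exact ⟨x.2, fun σ hσ => by
    simpa using (IntermediateField.mem_fixedField_iff _ _).mp hx σ hσ⟩

/-! ### Uniqueness of the extension from `E^h` to `E^sep`, and to all algebraic elements -/

/-- **Uniqueness on `E^sep`** (Kuhlmann 2010, §1.1: the decomposition field `K^h` is henselian —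
here the key step): if a valuation ring `W` of the algebraically closed `Ω` agrees with `V` on
`E^h`, then it agrees with `V` on `E^sep`. PROOF: `W ∩ E^sep` and `V ∩ E^sep` lie over the same
valuation ring of `E^h = Fix(D)`; by the conjugation theorem for the Galois extension
`E^sep|E^h` (Bourbaki, AC VI §8 no. 6, Cor. 1; `exists_smul_eq_of_isGalois`) they are
conjugate under some `τ ∈ Gal(E^sep|E^h) = D` (`mem_decompositionGroup_of_forall_apply_eq`),
and `τ` stabilises `V ∩ E^sep`. [cite: Kuhlmann2010, Section 1.1] -/
theorem mem_iff_mem_of_mem_separableClosure [IsAlgClosed Ω] (W : ValuationSubring Ω)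
    (hW : ∀ x ∈ henselization V E, x ∈ W ↔ x ∈ V) {x : Ω} (hx : x ∈ separableClosure E Ω) :
    x ∈ W ↔ x ∈ V := by
  -- the decomposition field as an intermediate field of `E^sep|E`, and the two rings on `E^sep`
  set Kh : IntermediateField E (separableClosure E Ω) :=
    IntermediateField.fixedField (decompositionGroup V E) with hKh
  set Ws : ValuationSubring (separableClosure E Ω) :=
    W.comap (algebraMap (separableClosure E Ω) Ω) with hWs
  -- they agree on `E^h`
  have hcomap : Ws.comap (algebraMap Kh (separableClosure E Ω)) =
      (sepClosureValuationSubring V E).comap (algebraMap Kh (separableClosure E Ω)) := by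
    ext k
    change ((k : separableClosure E Ω) : Ω) ∈ W ↔ ((k : separableClosure E Ω) : Ω) ∈ V
    apply hW
    rw [mem_henselization_iff]
    refine ⟨(k : separableClosure E Ω).2, fun σ hσ => ?_⟩
    simpa using (IntermediateField.mem_fixedField_iff _ _).mp k.2 σ hσ
  -- conjugation over `E^h` (`E^sep|E^h` is Galois as `E^sep|E` is)
  obtain ⟨τ, hτ⟩ := exists_smul_eq_of_isGalois Kh Ws (sepClosureValuationSubring V E) hcomap
  -- `τ`, as an `E`-automorphism, fixes `E^h`, hence lies in `D` and stabilises `V ∩ E^sep`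
  have hτD : τ.restrictScalars E ∈ decompositionGroup V E := by
    refine mem_decompositionGroup_of_forall_apply_eq V E _ fun y hy => ?_
    change τ y = y
    exact τ.commutes ⟨y, (IntermediateField.mem_lift y).mp hy⟩
  have hτV : τ.restrictScalars E • sepClosureValuationSubring V E =
      sepClosureValuationSubring V E :=
    (mem_decompositionGroup_iff V E _).mp hτD
  have hτW : τ.restrictScalars E • Ws = sepClosureValuationSubring V E := by
    rw [← hτ]
    ext y
    simp only [ValuationSubring.mem_smul_pointwise_iff_exists]
    rfl
  have hWV : Ws = sepClosureValuationSubring V E :=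
    smul_left_cancel (τ.restrictScalars E) (hτW.trans hτV.symm)
  -- conclude for `x ∈ E^sep`
  have h := SetLike.ext_iff.mp hWV ⟨x, hx⟩
  rwa [hWs, ValuationSubring.mem_comap, mem_sepClosureValuationSubring_iff] at h

/-- **Uniqueness on the algebraic closure of `E` in `Ω`** (purely inseparable lift; Bourbaki,
AC VI §8 no. 6, Cor. 2): if a valuation ring `W` of `Ω` agrees with `V` on `E^h`, it agrees with
`V` on every `x ∈ Ω` algebraic over `E`, because some power `x^m`, `m ≥ 1`, lies in `E^sep`
(`exists_pow_mem_separableClosure`) and `x ∈ W ↔ x^m ∈ W`.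
[cite: BourbakiAC5to7, Ch. VI §8 no. 6, Cor. 2] -/
theorem mem_iff_mem_of_isIntegral [IsAlgClosed Ω] (W : ValuationSubring Ω)
    (hW : ∀ x ∈ henselization V E, x ∈ W ↔ x ∈ V) {x : Ω} (hx : IsIntegral E x) :
    x ∈ W ↔ x ∈ V := by
  obtain ⟨m, hm, hxm⟩ := exists_pow_mem_separableClosure E hx
  rw [← pow_mem_iff_mem W hm x, ← pow_mem_iff_mem V hm x]
  exact mem_iff_mem_of_mem_separableClosure V E W hW hxm

/-- `E^h|E` is algebraic (indeed separable: `isSeparable_of_mem_henselization`); a theorem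
rather than an instance (theorems-only file), introduced with `haveI` where needed. [folklore] -/
theorem henselization_algebraIsIntegral : Algebra.IsIntegral E (henselization V E) :=
  ⟨fun k => (isIntegral_algebraMap_iff (algebraMap (henselization V E) Ω).injective).mp
    (isSeparable_of_mem_henselization V E k.2).isIntegral⟩

end Ambient

/-! ### The discharge -/

/-- **Discharge of `Kuhlmann2010HenselizationIsHenselian`** (Kuhlmann 2010, §1.1 with
Lemma 2.3: the henselization — the decomposition field of `(K^sep|K, v)` — is henselian, i.e.
its valuation extends uniquely to every algebraic extension). PROOF (see the module docstring):
embed the algebraic extension `L` of `E^h` into `Ω` over `E^h` (`IsAlgClosed.lift`), extend a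
valuation ring `O` of `L` over `V ∩ E^h` along the embedding `φ` to a valuation ring `W` of `Ω`
(Chevalley, `IsLocalRing.exists_factor_valuationRing`; `O = φ⁻¹ W` by maximality of valuation
rings for domination), and use that `W` is pinned down on all algebraic elements by its trace on
`E^h` (`mem_iff_mem_of_isIntegral`: conjugation theorem on `E^sep|E^h`, `Gal(E^sep|E^h) = D`,
purely inseparable lift): `x ∈ O ↔ φ x ∈ V`. [cite: Kuhlmann2010, Section 1.1 and Lemma 2.3] -/
theorem Kuhlmann2010HenselizationIsHenselian_holds : Kuhlmann2010HenselizationIsHenselian.{u} := by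
  intro Ω _ _ V E L _ _ hL O₁ O₂ h₁ h₂
  haveI := hL
  haveI := henselization_algebraIsIntegral V E
  -- an `E^h`-embedding of `L` into `Ω`
  let φ : L →ₐ[henselization V E] Ω := IsAlgClosed.lift
  suffices key : ∀ O : ValuationSubring L,
      O.comap (algebraMap (henselization V E) L) = V.comap (algebraMap (henselization V E) Ω) →
      ∀ y : L, y ∈ O ↔ φ y ∈ V by
    ext y
    rw [key O₁ h₁, key O₂ h₂]
  intro O hO y
  -- extend `O` along `φ` to a valuation ring `W` of `Ω` (Chevalley), `O = φ⁻¹ W`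
  obtain ⟨W, hWO, hloc⟩ := IsLocalRing.exists_factor_valuationRing (φ.toRingHom.comp O.subtype)
  have hOW : O = W.comap φ.toRingHom := by
    refine eq_of_le_of_inv_mem (fun x hx => hWO ⟨x, hx⟩) fun x hx hxinv => ?_
    by_cases hx0 : x = 0
    · rw [hx0, inv_zero]
      exact O.zero_mem
    rw [ValuationSubring.mem_comap] at hxinv
    have hu : IsUnit ((φ.toRingHom.comp O.subtype).codRestrict W.toSubring hWO ⟨x, hx⟩) := by
      refine IsUnit.of_mul_eq_one ⟨φ.toRingHom x⁻¹, hxinv⟩ (Subtype.ext ?_)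
      change φ x * φ x⁻¹ = 1
      rw [← map_mul, mul_inv_cancel₀ hx0, map_one]
    obtain ⟨v, hv⟩ := (IsLocalHom.map_nonunit _ hu).exists_right_inv
    have hxv : x⁻¹ = (v : L) := inv_eq_of_mul_eq_one_right (congrArg Subtype.val hv)
    rw [hxv]
    exact v.2
  -- `W` agrees with `V` on `E^h`
  have hWK : ∀ z ∈ henselization V E, z ∈ W ↔ z ∈ V := by
    intro z hz
    have h1 : (⟨z, hz⟩ : henselization V E) ∈ O.comap (algebraMap (henselization V E) L) ↔
        (⟨z, hz⟩ : henselization V E) ∈ V.comap (algebraMap (henselization V E) Ω) := by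
      rw [hO]
    rw [ValuationSubring.mem_comap, ValuationSubring.mem_comap, hOW,
      ValuationSubring.mem_comap] at h1
    have h2 : φ.toRingHom (algebraMap (henselization V E) L ⟨z, hz⟩) = z := φ.commutes ⟨z, hz⟩
    rw [h2] at h1
    exact h1
  -- `φ y` is algebraic over `E^h`, hence over `E`
  have hy : IsIntegral E (φ y) :=
    isIntegral_trans _ ((Algebra.IsAlgebraic.isAlgebraic y).algHom φ).isIntegral
  rw [hOW, ValuationSubring.mem_comap]
  exact mem_iff_mem_of_isIntegral V E W hWK hy

end Literature.AlgebraicGeometry.Resolution
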